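import Literature.Computability.MetaComplexity.BoundedArithS2Div
import HarnessLib

/-!
# Fixed-width blocks (sequence coding) in models of `S₂¹`

Topic `Literature/Computability/MetaComplexity`.  Third layer of the bootstrapping of Buss's `S₂¹`
inside an arbitrary model `M ⊨ BASIC + Σᵇ₁-PIND` (Buss 1986, §2.5: sequence coding by digits of a
fixed width; Krajíček 1995, §5.4), the `S₂¹` counterpart of the part `BoundedArithSeq` of
`BoundedArithSequences.lean` (models of `T₂¹`), in the algebraic notation of `BASICModel` and on
top of `msp`/`lsp`/`pw` of `BoundedArithS2Div.lean`:

* `blk S w i B = lsp S (msp S w (i·B)) B` — the block (base-`2ᴮ` digit) of `w` at block position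
  `i` (bit offset `i·B`; all offsets below `|S|`), its bounds and `Σᵇ₁`-definability;
* **appending a block on top** of a code `w < 2^{m·B}`: the new code `v·2^{m·B} + w` has block `m`
  equal to `lsp S v B`, the blocks below `m` unchanged, and is `< 2^{(m+1)·B}` when `v < 2ᴮ`
  (`blk_append_last`, `blk_append_of_lt`, `msp_append_eq_zero`) — this is how computations are
  accumulated without ever overwriting a digit (no subtraction is available in this tier);
* **extensionality**: codes below `2^{m·B}` with the same blocks below `m` are equal
  (`lsp_eq_lsp_of_blk_eq`, `eq_of_blk_eq`; `Σᵇ₁`-induction along `[0, m]`).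

## References

* S. R. Buss, *Bounded Arithmetic*, Bibliopolis 1986, §2.5.
* J. Krajíček, *Bounded Arithmetic, Propositional Logic and Complexity Theory*, CUP 1995, §5.4.
-/

namespace Literature.Computability.MetaComplexity

open FirstOrder FirstOrder.Language

namespace BASICModel

variable {M : Type} [Language.boundedArith.Structure M]

section S21

variable [hB : M ⊨ BASIC] [hP : M ⊨ PINDScheme (sigmabFormulas 1)]

/-! ## Blocks -/

/-- **`blk S w i B`**: the block of width `B` bits of `w` at block position `i`, i.e. the base-`2ᴮ`
digit `⌊w / 2^{i·B}⌋ mod 2ᴮ` (offsets below `|S|`) (Buss 1986, §2.5, the function `β(i, w)`;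
Krajíček 1995, §5.4). [cite: Buss1986, §2.5] -/
noncomputable def blk (S w i B : M) : M := lsp S (msp S w (i * B)) B

/-- A block is `< 2ᴮ`. [cite: Buss1986, §2.5] -/
theorem blk_lt (S w i B : M) : blk S w i B < pw S B := lsp_lt_pw _ _ _

/-- A block is `≤ w`. [cite: Buss1986, §2.5] -/
theorem blk_le (S w i B : M) : blk S w i B ≤ w := (lsp_le _ _ _).trans (msp_le _ _ _)

/-- `|blk S w i B| ≤ B` (`B ≤ |S|`). [cite: Buss1986, §2.5] -/
theorem mLen_blk_le {S B : M} (hB' : B ≤ mLen S) (w i : M) : mLen (blk S w i B) ≤ B :=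
  mLen_lsp_le hB'

/-- Blocks of `0` vanish. [folklore] -/
@[simp] theorem blk_zero (S i B : M) : blk S 0 i B = 0 := by simp [blk]

/-- **`blk` is a `Σᵇ₁`-definable function** of `(S, w, i, B)`. [cite: Buss1986, §2.5] -/
theorem isSigmabFn_blk : IsSigmabFn 1 fun u : Fin 4 → M => blk (u 0) (u 1) (u 2) (u 3) := by
  unfold blk
  -- inner: `msp S w (i·B)` as a function of `u`
  have h1 : IsSigmabFn 1 fun u : Fin 4 → M => msp (u 0) (u 1) (u 2 * u 3) :=
    isSigmabFn_msp.comp₃ (IsTermFn.proj 0) (IsTermFn.proj 1) (isTermFn_mul (IsTermFn.proj 2) (IsTermFn.proj 3))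
  -- `lsp S · B` with the definable middle argument
  have h2 : IsSigmabFn 1 fun u : Fin 5 → M => lsp (u 0) (u 4) (u 3) :=
    isSigmabFn_lsp.comp ![(0 : Fin 5), 4, 3]
  refine ⟨?_, fun u => u 1, IsTermFn.proj 1, fun u => blk_le _ _ _ _⟩
  have hg : IsSigmabDef 1 fun u : Fin 6 → M => u 4 = lsp (u 0) (u 5) (u 3) :=
    (h2.graph.comp ![(0 : Fin 6), 1, 2, 3, 5, 4]).of_iff fun u => by
      simp [graphPred, Fin.init, Fin.last]
  refine ((hg.snocFn (h1.comp Fin.castSucc)).of_iff fun v => ?_)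
  simp [graphPred, Fin.init, Fin.last]

/-! ## Appending a block on top -/

/-- If `w < 2ᵖ` (`msp S w p = 0`) then `msp S (v·2ᵖ + w) p = v`. [cite: Buss1986, §2.5] -/
theorem msp_mul_pw_add_of_msp_eq_zero {S w p : M} (hw : msp S w p = 0) (v : M) :
    msp S (v * pw S p + w) p = v := by
  rw [msp_mul_pw_add_self, hw, add_zero]

/-- **The appended block**: if `w < 2^{m·B}` then block `m` of `v·2^{m·B} + w` is `lsp S v B`.
[cite: Buss1986, §2.5] -/
theorem blk_append_last {S w v m B : M} (hw : msp S w (m * B) = 0) :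
    blk S (v * pw S (m * B) + w) m B = lsp S v B := by
  rw [blk, msp_mul_pw_add_of_msp_eq_zero hw]

/-- **Blocks below are unchanged** by appending on top: for `j < m` (written `j + e = m`, `e ≠ 0`)
and `m·B + B ≤ |S|`, block `j` of `v·2^{m·B} + w` is block `j` of `w`. [cite: Buss1986, §2.5] -/
theorem blk_append_of_lt {S w v m B j e : M} (hje : j + e = m) (he : e ≠ 0) (hmB : m * B ≤ mLen S) :
    blk S (v * pw S (m * B) + w) j B = blk S w j B := by
  obtain ⟨e', rfl⟩ := exists_eq_add_one_of_ne_zero_pind he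
  have hsplit : m * B = j * B + (B + e' * B) := by rw [← hje]; ring
  have hle : j * B + (B + e' * B) ≤ mLen S := hsplit ▸ hmB
  rw [blk, blk, hsplit, (msp_lsp_mul_pw_add_of_le hle v).1]
  -- `lsp S (v·2^{B + e'B} + msp S w (jB)) B = lsp S (msp S w (jB)) B`
  have hle' : B + e' * B ≤ mLen S := (le_add_left'' _ _).trans hle
  exact (msp_lsp_mul_pw_add_of_le hle' v).2

/-- **The appended code is again short**: if `w < 2^{m·B}` and `v < 2ᴮ` then
`v·2^{m·B} + w < 2^{(m+1)·B}`, i.e. `msp S (v·2^{m·B} + w) (m·B + B) = 0` (`m·B + B ≤ |S|`).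
[cite: Buss1986, §2.5] -/
theorem msp_append_eq_zero {S w v m B : M} (hw : msp S w (m * B) = 0) (hv : v < pw S B)
    (hmB : m * B + B ≤ mLen S) : msp S (v * pw S (m * B) + w) (m * B + B) = 0 := by
  rw [msp_add hmB, msp_mul_pw_add_of_msp_eq_zero hw, msp_eq_zero_of_lt hv]

/-- Variant with `(m + 1)·B`. [cite: Buss1986, §2.5] -/
theorem msp_append_eq_zero' {S w v m B : M} (hw : msp S w (m * B) = 0) (hv : v < pw S B)
    (hmB : (m + 1) * B ≤ mLen S) : msp S (v * pw S (m * B) + w) ((m + 1) * B) = 0 := by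
  have e : (m + 1) * B = m * B + B := by ring
  rw [e] at hmB ⊢
  exact msp_append_eq_zero hw hv hmB

/-- A code with `msp S w 0 = 0` is `0` (the empty sequence). [folklore] -/
theorem eq_zero_of_msp_zero {S w : M} (hw : msp S w 0 = 0) : w = 0 := by
  rwa [msp_zero_right] at hw

/-! ## Extensionality -/

/-- `lsp S w ((j+1)·B) = blk S w j B · 2^{j·B} + lsp S w (j·B)` (`j·B + B ≤ |S|`). [cite: Buss1986, §2.5] -/
theorem lsp_succ_mul (S w : M) {j B : M} (h : j * B + B ≤ mLen S) :
    lsp S w ((j + 1) * B) = blk S w j B * pw S (j * B) + lsp S w (j * B) := by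
  rw [show (j + 1) * B = j * B + B by ring, lsp_add h, blk]

/-- **Extensionality of block codes**: if the blocks of `w` and `w'` agree below `m` then
`lsp S w (m·B) = lsp S w' (m·B)` (`m·B ≤ |S|`, `m ≤ |S|`); by `Σᵇ₁`-induction on `j ∈ [0, m]`
for `lsp S w (j·B) = lsp S w' (j·B)` (Buss 1986, §2.5). [cite: Buss1986, §2.5] -/
theorem lsp_eq_lsp_of_blk_eq {S w w' m B : M} (hm : m ≤ mLen S) (hmB : m * B ≤ mLen S)
    (h : ∀ j, j < m → blk S w j B = blk S w' j B) : lsp S w (m * B) = lsp S w' (m * B) := by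
  obtain ⟨y, -, hy⟩ := exists_mLen_eq hm
  subst hy
  refine indLen (A := fun j => j ≤ mLen y → lsp S w (j * B) = lsp S w' (j * B)) ?_ y
    (fun _ => by simp) ?_ le_rfl le_rfl
  · refine IsSigmabDef.imp ((isQFDef_le (IsTermFn.proj 0) (IsTermFn.const (mLen y))).isPibDef 1) ?_
    exact ((isSigmabFn_lsp.comp₃ (IsTermFn.const S) (IsTermFn.const w)
      (isTermFn_mul (IsTermFn.proj 0) (IsTermFn.const B))).isDeltabDef_eq
      (isSigmabFn_lsp.comp₃ (IsTermFn.const S) (IsTermFn.const w')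
        (isTermFn_mul (IsTermFn.proj 0) (IsTermFn.const B)))).1
  · intro j hj ih hj1
    have hjB : j * B + B ≤ mLen S := by
      have : (j + 1) * B ≤ mLen y * B := mul_le_mul'' hj1 le_rfl
      rw [show (j + 1) * B = j * B + B by ring] at this
      exact this.trans hmB
    rw [lsp_succ_mul S w hjB, lsp_succ_mul S w' hjB, ih hj.le, h j hj]

/-- **Block codes are determined by their blocks**: if `w, w' < 2^{m·B}` have the same blocks below
`m` then `w = w'` (`m ≤ |S|`, `m·B ≤ |S|`). [cite: Buss1986, §2.5] -/
theorem eq_of_blk_eq {S w w' m B : M} (hm : m ≤ mLen S) (hmB : m * B ≤ mLen S)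
    (hw : msp S w (m * B) = 0) (hw' : msp S w' (m * B) = 0)
    (h : ∀ j, j < m → blk S w j B = blk S w' j B) : w = w' := by
  have e := lsp_eq_lsp_of_blk_eq hm hmB h
  rwa [lsp_eq_self_of_lt (msp_eq_zero_iff.1 hw), lsp_eq_self_of_lt (msp_eq_zero_iff.1 hw')] at e

/-- Blocks of a short code above its size vanish: if `msp S w (m·B) = 0` and `m ≤ j` (as
`m + e = j`), `j·B + B ≤ |S|`, then `blk S w j B = 0`. [folklore] -/
theorem blk_eq_zero_of_msp_eq_zero {S w m B j e : M} (hw : msp S w (m * B) = 0) (hje : m + e = j)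
    (hjB : j * B + B ≤ mLen S) : blk S w j B = 0 := by
  have hsplit : j * B = m * B + e * B := by rw [← hje]; ring
  have hle : m * B + e * B ≤ mLen S := hsplit ▸ (le_add_right'' _ _).trans hjB
  rw [blk, hsplit, msp_add hle, hw, msp_zero_mid, lsp_zero_mid]

end S21

end BASICModel

end Literature.Computability.MetaComplexity
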